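import Summits.BirchSwinnertonDyer.BirchSwinnertonDyer.Theorems.GenusKolyvaginAtTwoGenusPrimitiveSupplyAtTwoGenusReductionComposite

/-!
# Route `GenusKolyvaginAtTwo`, crux `GenusPrimitiveSupplyAtTwo` (stmt-BirchSwinnertonDyer-22136), line `genus-supply`:
# the θ-FIXED PART of `𝒢_n · y` is congruent to `P(n)` modulo `2A` — abstract operator algebra at composite level

Lead prover seat bsd-line-gk2-p1 (g2). Sequel of `…GenusReductionComposite` §1 (`P(n) ∈ 2A ⟺ Σ_{s∈S} s(∏_ℓ E_ℓ · y) ∈ 2A`,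
`E_ℓ = Σ_{i even ≤ ℓ} σ_ℓ^i`) and of `…GenusField` §1 (prime level). For a monoid `G` acting on an additive group `A`,
commuting `σ_ℓ` (`ℓ ∈ L`) with `2`-divisible traces `T_ℓ y`, «sign characters» `φ_ℓ` on `G` with
`φ_ℓ(g σ_ℓ^i) ↔ (φ_ℓ(g) ↔ i even)` and `φ_ℓ(g σ_ℓ'^i) ↔ φ_ℓ(g)` (`ℓ' ≠ ℓ`) — the shape of «`g` fixes `θ_ℓ = √ℓ*`» — and the
iterated image `SPAN σ L = {∏ σ_ℓ^{i_ℓ} : i_ℓ ≤ ℓ}` with injective stage maps: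
* §1 `exists_fixPart_eq_evenPart_add_two_zsmul`: on every coset `s · SPAN`, the sum of `g·y` over the `g` with ALL `φ_ℓ(g)`
  is `≡ s · ∏_ℓ E_ℓ · y (mod 2A)` — per coordinate the `φ_ℓ`-fixed exponents are the even ones or the odd ones, and
  `O_ℓ ≡ E_ℓ` on anything whose `T_ℓ`-trace is `2`-divisible.
* §2 `sum_filter_mul_eq_sum_sum`: summed over a set `S` of representatives with `(s,t) ↦ st` injective, this is the sum of
  `g·y` over `T = {g ∈ S·SPAN : ∀ ℓ, φ_ℓ(g)}`.
* §3 `exists_two_zsmul_eq_derivedPoint_iff_fixPart`: hence `P(n) ∈ 2A ⟺ Σ_{g∈T} g·y ∈ 2A` — the composite-level analogue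
  of the prime-level `heegner_exists_two_zsmul_eq_derivedPoint_iff_genusTrace`; the Heegner specialisation (`T =
  Gal(K[n]/K(√ℓ₁*,…,√ℓ_r*))`) is the next file.
Helper for the crux item (`--supports stmt-BirchSwinnertonDyer-22136`, helper mode). No summit and no leaf is proved by
this file; BSD is not proved by any of this.
-/

set_option linter.dupNamespace false -- tree convention: `Summit.BirchSwinnertonDyer.BirchSwinnertonDyer.Theorems` (summit = sub-problem)

noncomputable section

open scoped Classical

namespace Summit.BirchSwinnertonDyer.BirchSwinnertonDyer.Theorems.GenusKoly

open Finset Literature.NumberTheory.EllipticCurves.KolyvaginOperator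

/-! ## §0 Finset bookkeeping -/

section Finset

variable {A : Type*} [AddCommMonoid A]

/-- Sum over a filtered image along an injective map = filtered sum upstairs. [folklore] -/
theorem sum_filter_image_of_injOn {α β : Type*} [DecidableEq β] (s : Finset α) (f : α → β) (hinj : Set.InjOn f ↑s)
    (P : β → Prop) [DecidablePred P] (F : β → A) :
    ∑ g ∈ (s.image f).filter P, F g = ∑ a ∈ s.filter (fun a ↦ P (f a)), F (f a) := by
  rw [Finset.filter_image, Finset.sum_image]
  exact fun a ha b hb hab ↦ hinj (Finset.mem_of_mem_filter a ha) (Finset.mem_of_mem_filter b hb) hab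

/-- A filtered sum over a product = iterated sum with the filter on the inner variable. [folklore] -/
theorem sum_filter_product_eq {α β : Type*} (s : Finset α) (t : Finset β) (Q : α × β → Prop) [DecidablePred Q]
    (F : α × β → A) :
    ∑ p ∈ (s ×ˢ t).filter Q, F p = ∑ a ∈ s, ∑ b ∈ t.filter (fun b ↦ Q (a, b)), F (a, b) := by
  rw [Finset.sum_filter, Finset.sum_product]
  exact Finset.sum_congr rfl fun a _ ↦ by rw [Finset.sum_filter]

end Finset

section Operator

variable {G : Type*} [Monoid G] {A : Type*} [AddCommGroup A] (ρ : G →* AddMonoid.End A)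

/-- A sign character `φ_ℓ` that ignores every `σ_ℓ'`, `ℓ' ∈ L`, ignores every element of `SPAN σ L` on the right.
[folklore] -/
theorem iff_of_mem_span (σ : ℕ → G) (φ : G → Prop) (L : List ℕ)
    (hφ' : ∀ ℓ' ∈ L, ∀ (g : G) (i : ℕ), φ (g * σ ℓ' ^ i) ↔ φ g) :
    ∀ t ∈ L.foldr (fun ℓ T ↦ (range (ℓ + 1) ×ˢ T).image (fun p ↦ σ ℓ ^ p.1 * p.2)) ({1} : Finset G),
      ∀ g : G, φ (g * t) ↔ φ g := by
  induction L with
  | nil => intro t ht g; simp only [List.foldr_nil, Finset.mem_singleton] at ht; rw [ht, mul_one]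
  | cons ℓ L ih =>
    intro t ht g
    rw [List.foldr_cons, Finset.mem_image] at ht
    obtain ⟨⟨i, t'⟩, hit, rfl⟩ := ht
    rw [Finset.mem_product] at hit
    rw [← mul_assoc, ih (fun ℓ' h ↦ hφ' ℓ' (List.mem_cons_of_mem ℓ h)) t' hit.2, hφ' ℓ List.mem_cons_self]

/-! ## §1 The fixed part of a coset is `≡` the even part (mod `2A`) -/

/-- **On each coset `s · SPAN σ L`, the sum of `(st)·y` over the `t` with all `φ_ℓ(st)` (`ℓ ∈ L`) is
`≡ s · (∏_{ℓ∈L} E_ℓ) · y (mod 2A)`.** Hypotheses: `L` duplicate-free; the `σ_ℓ` (`ℓ ∈ L`) commute pairwise; every trace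
`T_ℓ y = Σ_{i≤ℓ} σ_ℓ^i y` is in `2A`; `φ_ℓ(gσ_ℓ^i) ↔ (φ_ℓ g ↔ i even)`, `φ_ℓ(gσ_ℓ'^i) ↔ φ_ℓ g` for `ℓ' ≠ ℓ` in `L`; the stage
maps `(i,t) ↦ σ_ℓ^i t` are injective on `range(ℓ+1) × SPAN σ L'` for every suffix `ℓ :: L'` of `L`. Induction on `L`: the
`φ_ℓ`-admissible exponents on the coset of `s` are the even ones if `φ_ℓ(s)` and the odd ones otherwise, and `O_ℓ X ≡ E_ℓ X`
for `X = ∏_{L'} E · y` because `T_ℓ X = ∏_{L'} E · (T_ℓ y) ∈ 2A` (`sum_pow_evenPart_comm`, `evenPart_zsmul`).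
[cite: GrossLMS1991, §3 (3.5), Prop. 3.7 (1), §4 (4.1)] [cite: SilvermanAEC2009, X.2 Prop. 2.4 (proof)] -/
theorem exists_fixPart_eq_evenPart_add_two_zsmul (σ : ℕ → G) (φ : ℕ → G → Prop) (y : A) :
    ∀ (L : List ℕ), L.Nodup →
      (∀ ℓ ∈ L, ∀ ℓ' ∈ L, Commute (σ ℓ) (σ ℓ')) →
      (∀ ℓ ∈ L, ∃ w : A, (2 : ℤ) • w = ∑ i ∈ range (ℓ + 1), ρ (σ ℓ ^ i) y) →
      (∀ ℓ ∈ L, ∀ (g : G) (i : ℕ), φ ℓ (g * σ ℓ ^ i) ↔ (φ ℓ g ↔ Even i)) →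
      (∀ ℓ ∈ L, ∀ ℓ' ∈ L, ℓ' ≠ ℓ → ∀ (g : G) (i : ℕ), φ ℓ (g * σ ℓ' ^ i) ↔ φ ℓ g) →
      (∀ (ℓ : ℕ) (L' : List ℕ), (ℓ :: L') <:+ L →
        Set.InjOn (fun p : ℕ × G ↦ σ ℓ ^ p.1 * p.2)
          ↑(range (ℓ + 1) ×ˢ L'.foldr (fun ℓ T ↦ (range (ℓ + 1) ×ˢ T).image (fun p ↦ σ ℓ ^ p.1 * p.2))
            ({1} : Finset G))) →
      ∀ s : G, ∃ z : A,
        ∑ t ∈ (L.foldr (fun ℓ T ↦ (range (ℓ + 1) ×ˢ T).image (fun p ↦ σ ℓ ^ p.1 * p.2)) ({1} : Finset G)).filter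
            (fun t ↦ ∀ ℓ ∈ L, φ ℓ (s * t)), ρ (s * t) y =
          ρ s (L.foldr (fun ℓ x ↦ ∑ i ∈ (range (ℓ + 1)).filter (fun i ↦ ¬ Odd i), ρ (σ ℓ ^ i) x) y) + (2 : ℤ) • z := by
  intro L
  induction L with
  | nil =>
    intro _ _ _ _ _ _ s
    refine ⟨0, ?_⟩
    simp
  | cons ℓ L ih =>
    intro hnd hcomm htr hφ hφ' hinj s
    have hℓL : ℓ ∉ L := (List.nodup_cons.mp hnd).1
    have hnd' : L.Nodup := (List.nodup_cons.mp hnd).2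
    have hcomm' : ∀ a ∈ L, ∀ b ∈ L, Commute (σ a) (σ b) := fun a ha b hb ↦
      hcomm a (List.mem_cons_of_mem ℓ ha) b (List.mem_cons_of_mem ℓ hb)
    have htr' : ∀ a ∈ L, ∃ w : A, (2 : ℤ) • w = ∑ i ∈ range (a + 1), ρ (σ a ^ i) y := fun a ha ↦
      htr a (List.mem_cons_of_mem ℓ ha)
    have hφL : ∀ a ∈ L, ∀ (g : G) (i : ℕ), φ a (g * σ a ^ i) ↔ (φ a g ↔ Even i) := fun a ha ↦
      hφ a (List.mem_cons_of_mem ℓ ha)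
    have hφ'L : ∀ a ∈ L, ∀ b ∈ L, b ≠ a → ∀ (g : G) (i : ℕ), φ a (g * σ b ^ i) ↔ φ a g := fun a ha b hb ↦
      hφ' a (List.mem_cons_of_mem ℓ ha) b (List.mem_cons_of_mem ℓ hb)
    have hinjL : ∀ (a : ℕ) (L' : List ℕ), (a :: L') <:+ L →
        Set.InjOn (fun p : ℕ × G ↦ σ a ^ p.1 * p.2)
          ↑(range (a + 1) ×ˢ L'.foldr (fun ℓ T ↦ (range (ℓ + 1) ×ˢ T).image (fun p ↦ σ ℓ ^ p.1 * p.2))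
            ({1} : Finset G)) := fun a L' h ↦ hinj a L' (h.trans (List.suffix_cons ℓ L))
    -- notation-free abbreviations
    set SP := L.foldr (fun ℓ T ↦ (range (ℓ + 1) ×ˢ T).image (fun p ↦ σ ℓ ^ p.1 * p.2)) ({1} : Finset G) with hSP
    set X := L.foldr (fun ℓ x ↦ ∑ i ∈ (range (ℓ + 1)).filter (fun i ↦ ¬ Odd i), ρ (σ ℓ ^ i) x) y with hX
    -- the stage map is injective
    have hstage := hinj ℓ L (List.suffix_refl _)
    -- per exponent `i`, the induction hypothesis at `s σ_ℓ^i`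
    have IH : ∀ i : ℕ, ∃ z : A, ∑ t ∈ SP.filter (fun t ↦ ∀ a ∈ L, φ a (s * σ ℓ ^ i * t)), ρ (s * σ ℓ ^ i * t) y =
        ρ (s * σ ℓ ^ i) X + (2 : ℤ) • z := fun i ↦ ih hnd' hcomm' htr' hφL hφ'L hinjL (s * σ ℓ ^ i)
    choose z hz using IH
    -- `φ_ℓ` ignores `SPAN σ L`; the `φ_a`, `a ∈ L`, ignore `σ_ℓ`
    have hφt : ∀ t ∈ SP, ∀ g : G, φ ℓ (g * t) ↔ φ ℓ g :=
      iff_of_mem_span σ (φ ℓ) L (fun a ha g i ↦ hφ' ℓ List.mem_cons_self a (List.mem_cons_of_mem ℓ ha)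
        (fun h ↦ hℓL (h ▸ ha)) g i)
    -- rewrite the fixed-part sum over the image
    rw [List.foldr_cons, sum_filter_image_of_injOn _ _ hstage, sum_filter_product_eq]
    -- inner filter: `φ_ℓ(s σ^i t) ∧ ∀ a ∈ L, φ_a(s σ^i t)` ⟷ `(φ_ℓ s ↔ Even i) ∧ ∀ a ∈ L, φ_a((s σ^i) t)`
    have hinner : ∀ i ∈ range (ℓ + 1),
        ∑ t ∈ SP.filter (fun t ↦ ∀ a ∈ ℓ :: L, φ a (s * (σ ℓ ^ i * t))), ρ (s * (σ ℓ ^ i * t)) y =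
          if (φ ℓ s ↔ Even i) then ρ (s * σ ℓ ^ i) X + (2 : ℤ) • z i else 0 := by
      intro i _
      split_ifs with hi
      · rw [← hz i]
        refine Finset.sum_congr (Finset.filter_congr fun t ht ↦ ?_) fun t _ ↦ by rw [mul_assoc]
        simp only [List.forall_mem_cons, ← mul_assoc]
        rw [hφt t ht, hφ ℓ List.mem_cons_self]
        exact ⟨fun h ↦ h.2, fun h ↦ ⟨hi, h⟩⟩
      · refine Finset.sum_eq_zero fun t ht ↦ ?_
        exfalso
        have h1 := ((Finset.mem_filter.mp ht).2 ℓ List.mem_cons_self)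
        rw [← mul_assoc, hφt t (Finset.mem_of_mem_filter t ht), hφ ℓ List.mem_cons_self] at h1
        exact hi h1
    rw [Finset.sum_congr rfl hinner, Finset.sum_ite, Finset.sum_const_zero, add_zero, Finset.sum_add_distrib,
      ← Finset.smul_sum]
    -- the head layer: `Σ_{i : φ_ℓ s ↔ Even i} s σ^i X ≡ s E_ℓ X`
    have hsX : ∑ i ∈ (range (ℓ + 1)).filter (fun i ↦ (φ ℓ s ↔ Even i)), ρ (s * σ ℓ ^ i) X =
        ρ s (∑ i ∈ (range (ℓ + 1)).filter (fun i ↦ (φ ℓ s ↔ Even i)), ρ (σ ℓ ^ i) X) := by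
      rw [map_sum]
      exact Finset.sum_congr rfl fun i _ ↦ by rw [map_mul]; rfl
    rw [hsX]
    -- `T_ℓ X ∈ 2A`
    obtain ⟨w, hw⟩ := htr ℓ List.mem_cons_self
    have htrX : ∑ i ∈ range (ℓ + 1), ρ (σ ℓ ^ i) X =
        (2 : ℤ) • L.foldr (fun ℓ x ↦ ∑ i ∈ (range (ℓ + 1)).filter (fun i ↦ ¬ Odd i), ρ (σ ℓ ^ i) x) w := by
      rw [hX, sum_pow_evenPart_comm ρ σ (σ ℓ) (range (ℓ + 1)) L
        (fun a ha ↦ hcomm ℓ List.mem_cons_self a (List.mem_cons_of_mem ℓ ha)) y, ← hw, evenPart_zsmul]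
    have hsplit := Finset.sum_filter_add_sum_filter_not (range (ℓ + 1)) Odd (fun i ↦ ρ (σ ℓ ^ i) X)
    rw [htrX] at hsplit
    by_cases hs : φ ℓ s
    · -- admissible exponents = even ones
      have hfilt : (range (ℓ + 1)).filter (fun i ↦ (φ ℓ s ↔ Even i)) = (range (ℓ + 1)).filter (fun i ↦ ¬ Odd i) :=
        Finset.filter_congr fun i _ ↦ by rw [Nat.not_odd_iff_even]; exact ⟨fun h ↦ h.mp hs, fun h ↦ ⟨fun _ ↦ h, fun _ ↦ hs⟩⟩
      refine ⟨∑ i ∈ (range (ℓ + 1)).filter (fun i ↦ (φ ℓ s ↔ Even i)), z i, ?_⟩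
      rw [hfilt, List.foldr_cons]
    · -- admissible exponents = odd ones; `O_ℓ X = T_ℓ X − E_ℓ X ≡ E_ℓ X`
      have hfilt : (range (ℓ + 1)).filter (fun i ↦ (φ ℓ s ↔ Even i)) = (range (ℓ + 1)).filter Odd :=
        Finset.filter_congr fun i _ ↦ by
          rw [← Nat.not_even_iff_odd]
          exact ⟨fun h he ↦ hs (h.mpr he), fun h ↦ ⟨fun hs' ↦ absurd hs' hs, fun he ↦ absurd he h⟩⟩
      refine ⟨ρ s (L.foldr (fun ℓ x ↦ ∑ i ∈ (range (ℓ + 1)).filter (fun i ↦ ¬ Odd i), ρ (σ ℓ ^ i) x) w)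
          - ρ s (∑ i ∈ (range (ℓ + 1)).filter (fun i ↦ ¬ Odd i), ρ (σ ℓ ^ i) X)
        + ∑ i ∈ (range (ℓ + 1)).filter (fun i ↦ (φ ℓ s ↔ Even i)), z i, ?_⟩
      rw [hfilt, List.foldr_cons, ← hX]
      have hodd : ∑ i ∈ (range (ℓ + 1)).filter Odd, ρ (σ ℓ ^ i) X =
          (2 : ℤ) • L.foldr (fun ℓ x ↦ ∑ i ∈ (range (ℓ + 1)).filter (fun i ↦ ¬ Odd i), ρ (σ ℓ ^ i) x) w
            - ∑ i ∈ (range (ℓ + 1)).filter (fun i ↦ ¬ Odd i), ρ (σ ℓ ^ i) X := by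
        rw [← hsplit]; abel
      rw [hodd, map_sub, map_zsmul]
      abel

/-! ## §2 Summing over the representatives: the fixed elements of `S · SPAN` -/

/-- **`Σ_{g ∈ T} g·y = Σ_{s∈S} Σ_{t ∈ SPAN, all φ_ℓ(st)} (st)·y`** when `(s,t) ↦ st` is injective on `S × SPAN σ L` and `T` is
the set of products `st` with all `φ_ℓ(st)`. [folklore] -/
theorem sum_filter_mul_eq_sum_sum (σ : ℕ → G) (φ : ℕ → G → Prop) (y : A) (L : List ℕ) (S T : Finset G)
    (hST : Set.InjOn (fun p : G × G ↦ p.1 * p.2)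
      ↑(S ×ˢ L.foldr (fun ℓ T ↦ (range (ℓ + 1) ×ˢ T).image (fun p ↦ σ ℓ ^ p.1 * p.2)) ({1} : Finset G)))
    (hT : ∀ g, g ∈ T ↔ (∃ s ∈ S, ∃ t ∈ L.foldr (fun ℓ T ↦ (range (ℓ + 1) ×ˢ T).image (fun p ↦ σ ℓ ^ p.1 * p.2))
      ({1} : Finset G), g = s * t) ∧ ∀ ℓ ∈ L, φ ℓ g) :
    ∑ g ∈ T, ρ g y =
      ∑ s ∈ S, ∑ t ∈ (L.foldr (fun ℓ T ↦ (range (ℓ + 1) ×ˢ T).image (fun p ↦ σ ℓ ^ p.1 * p.2))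
        ({1} : Finset G)).filter (fun t ↦ ∀ ℓ ∈ L, φ ℓ (s * t)), ρ (s * t) y := by
  set SP := L.foldr (fun ℓ T ↦ (range (ℓ + 1) ×ˢ T).image (fun p ↦ σ ℓ ^ p.1 * p.2)) ({1} : Finset G) with hSP
  have hTeq : T = ((S ×ˢ SP).image (fun p : G × G ↦ p.1 * p.2)).filter (fun g ↦ ∀ ℓ ∈ L, φ ℓ g) := by
    ext g
    rw [hT, Finset.mem_filter, Finset.mem_image]
    constructor
    · rintro ⟨⟨s, hs, t, ht, rfl⟩, hφ⟩
      exact ⟨⟨⟨s, t⟩, Finset.mem_product.mpr ⟨hs, ht⟩, rfl⟩, hφ⟩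
    · rintro ⟨⟨⟨s, t⟩, hst, rfl⟩, hφ⟩
      exact ⟨⟨s, (Finset.mem_product.mp hst).1, t, (Finset.mem_product.mp hst).2, rfl⟩, hφ⟩
  rw [hTeq, sum_filter_image_of_injOn _ _ hST, sum_filter_product_eq]

/-! ## §3 `P(n) ∈ 2A ⟺` the fixed part of `𝒢·y` is in `2A` -/

/-- **`P(n) ∈ 2A ⟺ Σ_{g ∈ T} g·y ∈ 2A`, abstract composite-level form.** With `L = n.primeFactorsList` and the hypotheses of
`exists_fixPart_eq_evenPart_add_two_zsmul` and `sum_filter_mul_eq_sum_sum`: the derived point `P(n) = Σ_{s∈S} s D_n y` is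
`2`-divisible iff the sum of `g·y` over `T = {st : s ∈ S, t ∈ SPAN, all φ_ℓ(st)}` is (`…GenusReductionComposite` §1:
`P(n) ≡ Σ_s s ∏E_ℓ y`; §1 here: `≡ Σ_s` fixed part; §2: `= Σ_T`). [cite: GrossLMS1991, §3 (3.5), Prop. 3.7 (1), §4 (4.1)] -/
theorem exists_two_zsmul_eq_derivedPoint_iff_fixPart (σ : ℕ → G) (φ : ℕ → G → Prop) (n : ℕ) (hn : Squarefree n)
    (S T : Finset G) (y : A)
    (hcomm : ∀ ℓ ∈ n.primeFactorsList, ∀ ℓ' ∈ n.primeFactorsList, Commute (σ ℓ) (σ ℓ'))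
    (htr : ∀ ℓ ∈ n.primeFactorsList, ∃ w : A, (2 : ℤ) • w = ∑ i ∈ range (ℓ + 1), ρ (σ ℓ ^ i) y)
    (hφ : ∀ ℓ ∈ n.primeFactorsList, ∀ (g : G) (i : ℕ), φ ℓ (g * σ ℓ ^ i) ↔ (φ ℓ g ↔ Even i))
    (hφ' : ∀ ℓ ∈ n.primeFactorsList, ∀ ℓ' ∈ n.primeFactorsList, ℓ' ≠ ℓ → ∀ (g : G) (i : ℕ), φ ℓ (g * σ ℓ' ^ i) ↔ φ ℓ g)
    (hinj : ∀ (ℓ : ℕ) (L' : List ℕ), (ℓ :: L') <:+ n.primeFactorsList →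
      Set.InjOn (fun p : ℕ × G ↦ σ ℓ ^ p.1 * p.2)
        ↑(range (ℓ + 1) ×ˢ L'.foldr (fun ℓ T ↦ (range (ℓ + 1) ×ˢ T).image (fun p ↦ σ ℓ ^ p.1 * p.2))
          ({1} : Finset G)))
    (hST : Set.InjOn (fun p : G × G ↦ p.1 * p.2)
      ↑(S ×ˢ n.primeFactorsList.foldr (fun ℓ T ↦ (range (ℓ + 1) ×ˢ T).image (fun p ↦ σ ℓ ^ p.1 * p.2))
        ({1} : Finset G)))
    (hT : ∀ g, g ∈ T ↔ (∃ s ∈ S, ∃ t ∈ n.primeFactorsList.foldr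
      (fun ℓ T ↦ (range (ℓ + 1) ×ˢ T).image (fun p ↦ σ ℓ ^ p.1 * p.2)) ({1} : Finset G), g = s * t) ∧
      ∀ ℓ ∈ n.primeFactorsList, φ ℓ g) :
    (∃ Q : A, (2 : ℤ) • Q = derivedPoint ρ σ n S y) ↔ ∃ Q : A, (2 : ℤ) • Q = ∑ g ∈ T, ρ g y := by
  rw [exists_two_zsmul_eq_derivedPoint_iff_evenPart ρ σ n S y hcomm htr,
    sum_filter_mul_eq_sum_sum ρ σ φ y n.primeFactorsList S T hST hT]
  have hnd : n.primeFactorsList.Nodup := (Nat.squarefree_iff_nodup_primeFactorsList hn.ne_zero).mp hn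
  have key := exists_fixPart_eq_evenPart_add_two_zsmul ρ σ φ y n.primeFactorsList hnd hcomm htr hφ hφ' hinj
  choose z hz using key
  rw [Finset.sum_congr rfl fun s _ ↦ hz s, Finset.sum_add_distrib, ← Finset.smul_sum]
  constructor
  · rintro ⟨Q, hQ⟩
    exact ⟨Q + ∑ s ∈ S, z s, by rw [smul_add, hQ]⟩
  · rintro ⟨Q, hQ⟩
    exact ⟨Q - ∑ s ∈ S, z s, by rw [smul_sub, hQ, add_sub_cancel_right]⟩

end Operator

end Summit.BirchSwinnertonDyer.BirchSwinnertonDyer.Theorems.GenusKoly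

end
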